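import Summits.QuantumFields.YangMills.Theorems.BalabanUVNodesN15KingModelTheorem21TwoPoint
import Summits.QuantumFields.YangMills.Theorems.BalabanUVNodesN15KingModelBlockCovarianceContinuumNE2Unit

/-!
# BalabanUVNodes ∕ N15 — THE KING-MODEL RUNG (PART Ϝ-f): NE2's UNIT LAYER INHABITED BY THE SCHWINGER PAIR `(S₂^{(K)}, S₂^{(∞)})` —
# `EtaRateIneqUnit` ∕ `NE2PlusUnit` ∕ `NE2ZeroUnit` ∕ `N15At` for the block-smeared two-point function of the free field against its continuum limit
# (Track A, DAG node N15 = NE2; FAN-OUT v1.1 §N15 s3 «KING-MODEL RUNG … NE2's analogue DECIDED in the model»)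

HONEST FRAMING.  Count-neutral (cell `pub-ymgap`, seat `pub-ymgap-dag-n15-e` g33; `--supports stmt-QuantumFields-27366 --as helper` = K3⁸
`SpineGivenEndpointR13SepCoPHV`).  TEMPLATE LITERATURE: C. King, *The U(1) Higgs model. I. The continuum limit*, Commun. Math. Phys. **102** (1986) 649–677
[King1986] — KING's OWN `A = 0`, `g = 0` MODEL on the King-model family of tori `Π_μ ℤ∕(2L^m)` (the g0 carriers `kingVolInstance`).  The unit-layer predicates
`T4EtaRate.EtaRateIneqUnit` ∕ `NE2PlusUnit` ([B9] Thm 3.15 (3.187)'s quantifier template) and the node's `YMDAG.UVSplit.N15At` are INHABITED by a NEW pair: the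
physically primary kernel of the free model — the Schwinger two-point function smeared on unit blocks, `S₂^{(K)} = N^d(QB⁻¹Qᵀ)(b,b′)` (part Ϝ-d) — read against its
`K = ∞` limit `S₂^{(∞)}`; part Ϡ-i did the same for the RG-technical kernel `(Δ^{(K)})⁻¹` (which is `S₂^{(K)}` plus the block-spin noise `a_K⁻¹·1`).  NOT Bałaban's
`C^{(k)}(Λ)`; NOT the carriers of record; NOT a node discharge (N15 is booked through n15-a's knit, untouched here); nothing continuum-Yang–Mills ∕ ℝ⁴ ∕ OS ∕ mass-gap ∕
Clay.  0 `sorry`; standard axioms; THREE definitions (`kingS2Step`, `kingS2Unit`, `kingVolCarriersSchwinger` — plumbing).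

THE MATHEMATICS.  Part Ϝ-d's `abs_kingS2_sub_lim_le`: `|S₂^{(K)}(b,b′) − S₂^{(∞)}(b,b′)| ≤ (2C_diff + a_∞⁻¹)e^{−(κ_M∕2)|b−b′|_T}(L^K)⁻¹` on every unit torus, in
particular on `Π ℤ∕(2L^m)` for every index `j = (m, K, Msz)`; this IS `EtaRateIneqUnit` with `(B₀, δ₀, θ) = (2C_diff + a_∞⁻¹, κ_M∕2, L⁻¹)` uniformly in `j`, hence
`NE2PlusUnit` (any `c35`, `a₀ = 1`), `NE2ZeroUnit`, and — with the g0 top piece on the operator and site layers — `N15At` at the King-model carriers (`d + 1 = 4`).  The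
auxiliary `a > 0` only enters the CONSTANTS (`S₂` is `a`-free); `a = 1` is fixed in the carrier bundle.

WHAT THIS FILE PROVES (kernel).  §1 `kingS2Step`, `kingS2Unit`, ★★ `kingS2_step_le` (Ϝ-d's rate at the volume `2L^m`), ★★★ **`etaRateIneqUnit_kingS2`**.  §2 ★★★ **`ne2PlusUnit_kingS2`**,
★★ `ne2ZeroUnit_kingS2`.  §3 `kingVolCarriersSchwinger`, ★★★ **`n15At_kingModelRung_schwinger`** (`N15At`, `d + 1 = 4`), `kingVolCarriersSchwinger_index_nonempty`; ★ `abs_kingS2Unit_lim_le`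
(the limit partner is bounded by `m⁻²` uniformly on the family — volume-free).

HONEST SCOPE.  King's free `A = 0` model; backgrounds range over `{U ≡ 1}`; `N15At` here is the node's SHAPE on model carriers, not `S_N15` at the record.  N15 untouched;
counts unmoved.  Locators: [King1986] (2.13)–(2.14) p.653, Thm 2.1 (2.22) p.654, Lemma 4.5 (4.38)–(4.41) pp.674–675; [Balaban1985BackgroundPropagators] Thm 3.15 (3.187) p.432.
-/

noncomputable section

namespace Summit.QuantumFields.YangMills.BalabanUVNodes.N15KingModelRung

open Real Finset
open Literature.MathematicalPhysics.QuantumFieldTheory.Balaban1983to89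
open Literature.MathematicalPhysics.QuantumFieldTheory.Balaban1983to89.T4EtaRate (PairedInstance EtaRateIneqUnit NE2PlusOperator NE2PlusSite NE2PlusUnit
  NE2ZeroOperator)
open Literature.MathematicalPhysics.QuantumFieldTheory.Balaban1983to89.T4EtaRateSiteOfRatePair (NE2ZeroSite)
open Literature.MathematicalPhysics.QuantumFieldTheory.Balaban1983to89.T4EtaRateUnitWitness (NE2ZeroUnit ne2ZeroUnit_of_ne2PlusUnit)
open Literature.MathematicalPhysics.QuantumFieldTheory.Balaban1983to89.B5Prop11Plancherel (Tor fine)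
open Literature.MathematicalPhysics.QuantumFieldTheory.King1986 (aK)
open Literature.MathematicalPhysics.QuantumFieldTheory.King1986.Torus (tdistT CdiffM kapM CdiffM_nonneg kapM_pos_le)
open YMDAG.UVSplit (NE2Carriers N15At)

variable {d : ℕ}

/-! ## §1 The Schwinger η-difference on the King-model family and the typed unit inequality -/

section Unit

variable (L : ℕ) [NeZero L]

/-- THE η-DIFFERENCE OF THE BLOCK-SMEARED TWO-POINT FUNCTION at index `j`: `S₂^{(K)}(b,b′) − S₂^{(∞)}(b,b′)` on the unit torus `Π ℤ∕(2L^m)`, `K = j.K`.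
[cite: King1986, Lemma 4.5 (4.38) p.674 (shape, n = ∞), (2.14) p.653] -/
def kingS2Step (m2 : ℝ) (j : KingVolIndex d) (b b' : Tor (kingVol L j)) : ℝ :=
  haveI := kingVol_neZero L j
  kingS2 (L ^ j.K) (kingVol L j) m2 b b' - kingS2Lim (kingVol L j) m2 b b'

/-- The Schwinger η-difference as the UNIT-LAYER site kernel on the King-model family. [cite: Balaban1985BackgroundPropagators, Thm 3.15 (3.187) p.432 (shape); King1986, (4.38) p.674 (object)] -/
def kingS2Unit (m2 : ℝ) : ∀ j : KingVolIndex d, B9.SiteKernel (kingVolInstance d L j).gc (kingVolInstance d L j).Bf :=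
  fun j => ⟨fun _ b b' => kingS2Step L m2 j b b'⟩

/-- ★★ **THE (4.38)-SHAPE FOR THE SCHWINGER PAIR ON THE KING-MODEL FAMILY** (`L` odd `≥ 2`, `m² > 0`, auxiliary `a > 0`): for EVERY index and all unit sites,
`|S₂^{(K)}(b,b′) − S₂^{(∞)}(b,b′)| ≤ (2C_diff + a_∞⁻¹)·e^{−(κ_M∕2)|b − b′|_T}·(L^K)⁻¹` — part Ϝ-d's `abs_kingS2_sub_lim_le` BY NAME at the volume `2L^m`.
[cite: King1986, Lemma 4.5 (4.38) p.674, (4.39)–(4.41) pp.674–675] -/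
theorem kingS2_step_le (hLodd : Odd L) (hL : 2 ≤ L) {a m2 : ℝ} (ha : 0 < a) (hm : 0 < m2) (j : KingVolIndex d) (b b' : Tor (kingVol L j)) :
    haveI := kingVol_neZero L j
    |kingS2Step L m2 j b b'| ≤
      (2 * CdiffM (d + 1) a m2 L + (aInf a L)⁻¹) * Real.exp (-(kapM (d + 1) a m2 L / 2 * tdistT (kingVol L j) b b')) * ((L : ℝ) ^ j.K)⁻¹ := by
  haveI := kingVol_neZero L j
  have h := abs_kingS2_sub_lim_le L (kingVol L j) hLodd hL ha hm j.one_le_K b b'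
  unfold kingS2Step
  convert h using 3

/-- ★★★ **THE TYPED UNIT INEQUALITY FOR THE SCHWINGER PAIR, UNIFORMLY** (`L` odd `≥ 2`, `m² > 0`, auxiliary `a > 0`): for EVERY index and (the unique) background,
`EtaRateIneqUnit (kingS2Unit L m² j) (fun _ => True) (kingUnitDist L j) (2C_diff + a_∞⁻¹) (κ_M∕2) L⁻¹ K`.
[cite: Balaban1985BackgroundPropagators, Thm 3.15 (3.187) p.432 (shape); King1986, (4.38) p.674, (4.41) p.675] -/
theorem etaRateIneqUnit_kingS2 (hLodd : Odd L) (hL : 2 ≤ L) {a m2 : ℝ} (ha : 0 < a) (hm : 0 < m2) (j : KingVolIndex d)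
    (U : (kingVolInstance d L j).Bf.Cfg) :
    EtaRateIneqUnit (kingS2Unit L m2 j) (fun _ => True) (kingUnitDist L j) (2 * CdiffM (d + 1) a m2 L + (aInf a L)⁻¹)
      (kapM (d + 1) a m2 L / 2) ((L : ℝ)⁻¹) j.K U := by
  intro y y' _ _
  haveI := kingVol_neZero L j
  have h := kingS2_step_le (d := d) L hLodd hL ha hm j y y'
  show |kingS2Step L m2 j y y'| ≤
    (2 * CdiffM (d + 1) a m2 L + (aInf a L)⁻¹) * Real.exp (-(kapM (d + 1) a m2 L / 2 * tdistT (kingVol L j) y y')) * ((L : ℝ)⁻¹) ^ j.K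
  rw [inv_pow]
  exact h

/-! ## §2 `NE2PlusUnit` ∕ `NE2ZeroUnit` for the Schwinger pair -/

/-- ★★★ **`NE2PlusUnit` IS INHABITED BY THE SCHWINGER PAIR `(S₂^{(K)}, S₂^{(∞)})` ON THE KING-MODEL FAMILY, HYPOTHESIS-FREE** (`L` odd `≥ 2`, `m² > 0`, every `c35`;
constants from any auxiliary `a > 0`): `(δ₀, a₀, B₀, θ) = (κ_M∕2, 1, 2C_diff + a_∞⁻¹, L⁻¹)`, uniform in `(m, K, Msz)`.  HONEST SCOPE: backgrounds range over `{U ≡ 1}`.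
[cite: Balaban1985BackgroundPropagators, Thm 3.15 (3.187) p.432 (quantifier template); King1986, Lemma 4.5 (4.38) p.674, Thm 2.1 (2.22) p.654] -/
theorem ne2PlusUnit_kingS2 (hLodd : Odd L) (hL : 2 ≤ L) {a m2 : ℝ} (ha : 0 < a) (hm : 0 < m2) (c35 : ℝ) :
    NE2PlusUnit c35 (kingVolInstance d L) (kingS2Unit L m2) (fun _ _ => True) (kingUnitDist L) := by
  have hLpos : (0 : ℝ) < L := by exact_mod_cast (lt_of_lt_of_le zero_lt_two hL)
  have hL1 : (1 : ℝ) < L := by exact_mod_cast (show 1 < L by omega)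
  have hθ1 : (L : ℝ)⁻¹ < 1 := inv_lt_one_of_one_lt₀ (by exact_mod_cast hL)
  have haI := aInf_pos ha hL1
  have hC : 0 < 2 * CdiffM (d + 1) a m2 L + (aInf a L)⁻¹ := by
    have := CdiffM_nonneg (d := d + 1) ha hm hL
    positivity
  exact ⟨kapM (d + 1) a m2 L / 2, 1, 2 * CdiffM (d + 1) a m2 L + (aInf a L)⁻¹, (L : ℝ)⁻¹, half_pos (kapM_pos_le ha hm hL).1, one_pos, hC,
    inv_pos.mpr hLpos, hθ1, fun j _ _ _ U _ _ => etaRateIneqUnit_kingS2 L hLodd hL ha hm j U⟩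

/-- ★★ **`NE2ZeroUnit` FOR THE SCHWINGER PAIR** (same data): the lineage's `ne2ZeroUnit_of_ne2PlusUnit`. [cite: King1986, (4.38) p.674 (A = 0 model, n = ∞)] -/
theorem ne2ZeroUnit_kingS2 (hLodd : Odd L) (hL : 2 ≤ L) {m2 : ℝ} (hm : 0 < m2) :
    NE2ZeroUnit (kingVolInstance d L) (kingS2Unit L m2) (fun _ _ => True) (kingUnitDist L) :=
  ne2ZeroUnit_of_ne2PlusUnit (c35 := 0) (fun j => lt_of_lt_of_le one_pos j.one_le_Msz) (fun _ _ _ => trivial)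
    (fun _ _ _ => trivial) (ne2PlusUnit_kingS2 L hLodd hL one_pos hm 0)

/-- ★ The limit partner is bounded by `m⁻²` uniformly on the family (volume-free; part Ϝ-d). [cite: King1986, Thm 2.1 (2.23) p.654, (4.8) p.671] -/
theorem abs_kingS2Unit_lim_le (hLodd : Odd L) (hL : 2 ≤ L) {m2 : ℝ} (hm : 0 < m2) (j : KingVolIndex d) (b b' : Tor (kingVol L j)) :
    haveI := kingVol_neZero L j
    |kingS2Lim (kingVol L j) m2 b b'| ≤ m2⁻¹ := by
  haveI := kingVol_neZero L j
  exact abs_kingS2Lim_le L (kingVol L j) hLodd hL hm b b'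

end Unit

/-! ## §3 `N15At` at the King-model carriers with the Schwinger unit layer -/

section Node

variable (L : ℕ) [NeZero L]

/-- THE KING-MODEL CARRIER BUNDLE WITH THE SCHWINGER UNIT LAYER (`d + 1 = 4`): as the g0 `kingVolCarriers` (top piece on the operator and site layers) but
`Kunit := kingS2Unit` — the unit-layer η-difference read as `(S₂^{(K)}, S₂^{(∞)})`.  NOT the carriers of record. [cite: King1986, (2.14) p.653, (4.38) p.674 (objects)] -/
def kingVolCarriersSchwinger (a m2 c35 p : ℝ) : NE2Carriers where
  I := KingVolIndex 3
  c35 := c35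
  p := p
  pi := kingVolInstance 3 L
  Kop := topPieceOp L a m2
  Ksite := topPieceSite L a m2
  Kunit := kingS2Unit L m2
  inΛ := fun _ _ => True
  unitDist := kingUnitDist L

/-- ★★★ **`N15At` AT THE KING-MODEL CARRIERS WITH THE SCHWINGER UNIT LAYER, HYPOTHESIS-FREE** (odd `L ≥ 3`, `a, m² > 0`, `0 < γ ≤ 1`, every `c35`, `p`; `d + 1 = 4`):
`NE2PlusOperator ∧ NE2PlusSite 4 p ∧ NE2PlusUnit` on ONE family, the unit layer being the free Schwinger pair `(S₂^{(K)}, S₂^{(∞)})`.  NOT `S_N15 RRec`, NOT a discharge.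
[cite: King1986, Prop. 3.9 (3.73) p.665, Lemma 4.5 (4.38) p.674, Thm 2.1 (2.22) p.654; Balaban1985BackgroundPropagators, Thm 3.1 p.397 + Thm 3.2 (3.48) p.398 + Thm 3.15 (3.187) p.432 (quantifier templates)] -/
theorem n15At_kingModelRung_schwinger (hLodd : Odd L) (hL : 2 ≤ L) {a m2 : ℝ} (ha : 0 < a) (hm : 0 < m2) {γ : ℝ} (hγ0 : 0 < γ) (hγ1 : γ ≤ 1) (c35 p : ℝ) :
    N15At (kingVolCarriersSchwinger L a m2 c35 p) :=
  ⟨ne2PlusOperator_topPiece (d := 3) L hLodd hL ha hm hγ0 hγ1 c35, ne2PlusSite_topPiece (d := 3) L hLodd hL ha hm hγ0 hγ1 4 p c35,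
    ne2PlusUnit_kingS2 (d := 3) L hLodd hL ha hm c35⟩

/-- The bundle's index type is inhabited (not the empty-index trap). [folklore] -/
theorem kingVolCarriersSchwinger_index_nonempty (a m2 c35 p : ℝ) : Nonempty (kingVolCarriersSchwinger L a m2 c35 p).I :=
  kingVolIndex_nonempty 3

end Node

end Summit.QuantumFields.YangMills.BalabanUVNodes.N15KingModelRung

end
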